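import Summits.HodgeConjecture.HodgeConjecture.Theorems.NoetherLefschetzOneUpK3TypeNetsSurfaceProductsCorrespondences
import Summits.HodgeConjecture.HodgeConjecture.Theorems.NoetherLefschetzOneUpK3TypeNetsPgZeroFactor
import Literature.AlgebraicGeometry.HodgeTheory.HardLefschetzNFoldHolds
import Literature.AlgebraicGeometry.HodgeTheory.AbelJacobiPullbackHodgeSection

/-!
# Crux `K3TypeNets` (stmt-HodgeConjecture-11600), product sector — the Hodge conjecture for `S₁ × S₂`
# reduces to the transcendental correspondences `T(S₂) → T(S₁)`

Second helper for the product-sector line of crux `K3TypeNets` (stubs P2 `stub_k3Pairs`, P3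
`stub_residualPgOnePairs`: `HC(2,2)` for `S₁ × S₂` "⟺ every Hodge morphism `T(S₂)_ℚ → T(S₁)_ℚ` is induced
by an algebraic class"). For TWO arbitrary smooth projective complex surfaces `S₁`, `S₂`:

* `mem_supportedClasses_one_of_corrFst_eq_zero₂` — a class `w ∈ H⁴((S₁ ⊗ S₂)(ℂ))` acting trivially on
  `H²(S₂) → H²(S₁)` is supported on a divisor (Künneth `kunnethSpan_complexBetti`; cross products with a
  factor of degree `≥ 3` are divisor-supported and act by zero; the `H² ⊗ H²` part `Σ pr₁^* v_α ∪ pr₂^* B_α`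
  acts by `y ↦ κ Σ (∫_{S₂} y ∪ B_α) v_α`, so it vanishes by Poincaré duality on `S₂`) — NO hypothesis on
  `H¹` of either factor;
* `hodgeTwoTwo_algebraic_prod_of_transcendentalCorrespondences` — **the reduction**: if every rational,
  type-preserving `f : H²(S₂) → H²(S₁)` killing `N¹H²(S₂)` with image orthogonal to `N¹H²(S₁)` agrees on
  `T(S₂)` with the action of an algebraic class of `S₁ × S₂`, then every rational `(2,2)`-class on `S₁ × S₂`
  is algebraic (`exists_algebraicClass_of_corrFst₂`; `z - Γ ∈ N¹H⁴`; rational `(2,2)` + divisor-supported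
  ⟹ algebraic by the CLOSED item `NodalSupport.DivisorInduction`,
  `PgOneProductClasses.mem_algebraicClasses_two_of_mem_supportedClasses_one`);
  `hodgeConjectureFor_prod_of_transcendentalCorrespondences` — hence `HodgeConjectureFor 4 (S₁ ⊗ S₂)`
  (Lefschetz `(1,1)`, hard Lefschetz, Hodge models — all PROVED);
* `hodgeConjectureFor_prod_of_hom_transcendental_eq_zero` — **unconditional corollary**: if there is NO
  non-zero rational Hodge morphism `T(S₂) → T(S₁)` (every `f` as above vanishes on `T(S₂)`), e.g. for two K3
  surfaces with non-isogenous transcendental lattices or for `p_g(S₂) = 0`, then the Hodge conjecture holds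
  for `S₁ ⊗ S₂`.

The case `S₁ = S₂` on the `√2`-sector is `SquareGlueFree.squareGlue_proof` (item 13682). No definition, no
named-fact hypothesis, no sorry. Prover seat ring2-b02 (gen 47).

References: Huybrechts, *Motives of isogenous K3 surfaces* (2019), §1 and Cor. 0.4; Varesco (2023), §2 p. 8;
Voisin, *Hodge Theory and Complex Algebraic Geometry I*, Thm. 11.30, Lemma 11.41, Thm. 6.25; Hatcher,
*Algebraic Topology*, Thm. 3.16, Prop. 3.38; Deligne, Hodge III, Cor. 8.2.8.
-/

set_option linter.dupNamespace false

noncomputable section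

namespace Summit.HodgeConjecture.HodgeConjecture.Theorems.SurfaceProducts

open scoped Manifold
open CategoryTheory MonoidalCategory CartesianMonoidalCategory
open Literature.AlgebraicGeometry Literature.AlgebraicGeometry.Motives Literature.AlgebraicGeometry.HodgeTheory
open Literature.AlgebraicTopology.SingularHomology
open Summit.HodgeConjecture.HodgeConjecture.Theorems.NikulinTwinTransport

variable {S₁ S₂ : SchemeOver ℂ}

/-- `Corr[μ, h₁, h₂ ; γ, y] = pr₁_*(pr₂^* y ∪ γ) : H²(S₂(ℂ)) → H²(S₁(ℂ))`. Local notation only. -/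
local notation3 (prettyPrint := false) "Corr[" μ ", " h₁ ", " h₂ " ; " γ ", " y "]" =>
  complexGysin μ (IsSmoothProjective.tensor_holds h₁ h₂) h₁
    (SemiCartesianMonoidalCategory.fst _ _) (rfl : 2 * 1 + 2 * 2 + 2 * 2 = 2 * 1 + 2 * (2 + 2))
    (cupProduct (rfl : 2 * 1 + 2 * 2 = 2 * 1 + 2 * 2)
      (complexBetti.map (SemiCartesianMonoidalCategory.snd _ _) (2 * 1) y) γ)

/-! ### A class acting trivially on `H²` is supported on a divisor -/

/-- **A class of `H⁴((S₁ ⊗ S₂)(ℂ); ℂ)` whose action `H²(S₂) → H²(S₁)`, `y ↦ pr₁_*(pr₂^* y ∪ w)`, vanishes is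
supported on a divisor** (`w ∈ N¹H⁴`), for all smooth projective surfaces `S₁`, `S₂` and every orientation
family. Künneth (`kunnethSpan_complexBetti`) splits `w = w₀ + w₂₂`; the cross products with a factor of
degree `≥ 3` are divisor-supported (`mem_supportedClasses_one_of_dim_lt`, pull-back along a surjective
projection, cup product) and act by zero in degree `2` (`corrFst_cross_eq_zero_of_lt/gt`); the `H² ⊗ H²` part
`Σ_α pr₁^* v_α ∪ pr₂^* B_α` over a basis `(v_α)` of `H²(S₁)` acts by `y ↦ κ Σ_α (∫_{S₂} y ∪ B_α) v_α` with
`κ ≠ 0` (`corrFst_cross_of_cup_eq`, `exists_fibreIntegral_fst`), so every `B_α` pairs to zero with `H²(S₂)`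
and vanishes (`eq_zero_of_forall_cupPairing_eq_zero`). [cite: HatcherAT2002, §3.2 Thm. 3.16 and §3.3 Prop. 3.38]
[cite: VoisinHodgeI2002, §11.3.3 Lemma 11.41] -/
theorem mem_supportedClasses_one_of_corrFst_eq_zero₂ (μ : OrientationFamily) (h₁ : IsSmoothProjective 2 S₁)
    (h₂ : IsSmoothProjective 2 S₂) {w : complexBetti (S₁ ⊗ S₂) (2 * 2)}
    (hw : ∀ y : complexBetti S₂ (2 * 1), Corr[μ, h₁, h₂ ; w, y] = 0) :
    w ∈ supportedClasses (S₁ ⊗ S₂) (2 * 2) 1 := by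
  classical
  have h4 : 2 * 1 + 2 * 1 = 2 * 2 := rfl
  have hSS : IsSmoothProjective (2 + 2) (S₁ ⊗ S₂) := IsSmoothProjective.tensor_holds h₁ h₂
  obtain ⟨y₁⟩ := nonempty_complexPoints h₁
  obtain ⟨y₂⟩ := nonempty_complexPoints h₂
  have hfst : Function.Surjective (fst S₁ S₂).left.base := surjective_fst_left_base y₂
  have hsnd : Function.Surjective (snd S₁ S₂).left.base := PgOneProductClasses.surjective_snd_left_base y₁
  set V₀ : Submodule ℂ (complexBetti (S₁ ⊗ S₂) (2 * 2)) := Submodule.span ℂ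
    {v | ∃ (i j : ℕ) (h : i + j = 2 * 2) (b : complexBetti S₁ i) (w' : complexBetti S₂ j), j ≠ 2 ∧
      v = cupProduct h (complexBetti.map (fst S₁ S₂) i b) (complexBetti.map (snd S₁ S₂) j w')} with hV₀
  set V₂ : Submodule ℂ (complexBetti (S₁ ⊗ S₂) (2 * 2)) := Submodule.span ℂ
    {v | ∃ (a : complexBetti S₁ (2 * 1)) (b : complexBetti S₂ (2 * 1)),
      v = cupProduct h4 (complexBetti.map (fst S₁ S₂) (2 * 1) a) (complexBetti.map (snd S₁ S₂) (2 * 1) b)}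
    with hV₂
  have hwsup : w ∈ V₀ ⊔ V₂ := by
    refine (Submodule.span_le.2 ?_) (kunnethSpan_complexBetti h₁ h₂ (2 * 2) w)
    rintro v ⟨i, j, hij, b, w', rfl⟩
    by_cases hj : j = 2
    · obtain rfl : j = 2 * 1 := by omega
      obtain rfl : i = 2 * 1 := by omega
      exact Submodule.mem_sup_right (Submodule.subset_span ⟨b, w', rfl⟩)
    · exact Submodule.mem_sup_left (Submodule.subset_span ⟨i, j, hij, b, w', hj, rfl⟩)
  obtain ⟨w₀, hw₀, w₂, hw₂, rfl⟩ := Submodule.mem_sup.1 hwsup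
  have hV₀N : V₀ ≤ supportedClasses (S₁ ⊗ S₂) (2 * 2) 1 := by
    refine Submodule.span_le.2 ?_
    rintro v ⟨i, j, hij, b, w', hj, rfl⟩
    by_cases hj3 : 3 ≤ j
    · have hw' : w' ∈ supportedClasses S₂ j 1 := mem_supportedClasses_one_of_dim_lt h₂ (by omega) w'
      exact cupProduct_mem_supportedClasses_right hij _
        (map_mem_supportedClasses_one_of_surjective hSS h₂ (snd S₁ S₂) hsnd hw')
    · have hb : b ∈ supportedClasses S₁ i 1 := mem_supportedClasses_one_of_dim_lt h₁ (by omega) b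
      exact PullbackAlgebraicNormalCone.CupDivisor.cupProduct_mem_supportedClasses_left hij
        (map_mem_supportedClasses_one_of_surjective hSS h₁ (fst S₁ S₂) hfst hb) _
  have hV₀act : ∀ v ∈ V₀, ∀ y : complexBetti S₂ (2 * 1), Corr[μ, h₁, h₂ ; v, y] = 0 := by
    intro v hv y
    induction hv using Submodule.span_induction with
    | mem v hv =>
      obtain ⟨i, j, hij, b, w', hj, rfl⟩ := hv
      by_cases hj3 : 3 ≤ j
      · exact corrFst_cross_eq_zero_of_gt μ h₁ h₂ hij (rfl : 2 * 1 + 2 * 2 = 2 * 1 + 2 * 2)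
          (rfl : 2 * 1 + 2 * 2 + 2 * 2 = 2 * 1 + 2 * (2 + 2)) (by omega) y b w'
      · exact corrFst_cross_eq_zero_of_lt μ h₁ h₂ hij (rfl : 2 * 1 + 2 * 2 = 2 * 1 + 2 * 2)
          (rfl : 2 * 1 + 2 * 2 + 2 * 2 = 2 * 1 + 2 * (2 + 2)) (by omega) y b w'
    | zero => rw [map_zero, map_zero]
    | add v v' _ _ hv hv' => rw [map_add, map_add, hv, hv', add_zero]
    | smul t v _ hv => rw [map_smul, map_smul, hv, smul_zero]
  have hw₂act : ∀ y : complexBetti S₂ (2 * 1), Corr[μ, h₁, h₂ ; w₂, y] = 0 := fun y ↦ by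
    have h := hw y
    rwa [map_add, map_add, hV₀act w₀ hw₀ y, zero_add] at h
  obtain ⟨ρ, v, -⟩ := exists_basis_isRationalClass h₁ (2 * 1)
  have hnf : ∀ x ∈ V₂, ∃ B : Fin ρ → complexBetti S₂ (2 * 1),
      x = ∑ α, cupProduct h4 (complexBetti.map (fst S₁ S₂) (2 * 1) (v α))
        (complexBetti.map (snd S₁ S₂) (2 * 1) (B α)) := by
    intro x hx
    induction hx using Submodule.span_induction with
    | mem x hx =>
      obtain ⟨a, b, rfl⟩ := hx
      refine ⟨fun α ↦ (v.repr a α) • b, ?_⟩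
      conv_lhs => rw [← v.sum_repr a]
      rw [map_sum, map_sum, LinearMap.sum_apply]
      refine Finset.sum_congr rfl fun α _ ↦ ?_
      rw [map_smul, map_smul, LinearMap.smul_apply, map_smul, map_smul]
    | zero => exact ⟨0, by simp⟩
    | add x x' _ _ hx hx' =>
      obtain ⟨B, rfl⟩ := hx
      obtain ⟨B', rfl⟩ := hx'
      exact ⟨B + B', by simp [Finset.sum_add_distrib, map_add]⟩
    | smul t x _ hx =>
      obtain ⟨B, rfl⟩ := hx
      exact ⟨t • B, by simp [Finset.smul_sum, map_smul]⟩
  obtain ⟨B, hB⟩ := hnf w₂ hw₂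
  obtain ⟨ω, hω⟩ := exists_traceC_eq_one h₂
  have hω0 : ω ≠ 0 := by
    rintro rfl
    rw [map_zero] at hω
    exact zero_ne_one hω
  obtain ⟨κ, hκ0, hκ⟩ := exists_fibreIntegral_fst μ h₁ h₂ (kunnethSpan_complexBetti h₁ h₂ (2 * (2 + 2)))
    hω0 (rfl : 2 * 2 + 2 * 2 = 0 + 2 * (2 + 2))
  have hact : ∀ y : complexBetti S₂ (2 * 1),
      Corr[μ, h₁, h₂ ; w₂, y] = ∑ α, (traceC h₂ (cupProduct h4 y (B α)) * κ) • v α := by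
    intro y
    rw [hB, map_sum, map_sum]
    refine Finset.sum_congr rfl fun α _ ↦ ?_
    rw [corrFst_cross_of_cup_eq μ h₁ h₂ h4 (rfl : 2 * 1 + 2 * 2 = 2 * 1 + 2 * 2) h4
      (rfl : 2 * 1 + 2 * 2 + 2 * 2 = 2 * 1 + 2 * (2 + 2)) (rfl : 2 * 2 + 2 * 2 = 0 + 2 * (2 + 2)) hκ
      (v α) (eq_traceC_smul h₂ hω (cupProduct h4 y (B α)))]
    congr 1
    rw [show ((-1 : ℂ) ^ (2 * 1 * (2 * 1))) = 1 by norm_num, one_mul]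
  have hB0 : ∀ α, B α = 0 := by
    intro α
    have hyB : ∀ y : complexBetti S₂ (2 * 1), cupProduct h4 y (B α) = 0 := by
      intro y
      have h0 := hw₂act y
      rw [hact y] at h0
      have hcoef := Fintype.linearIndependent_iff.1 v.linearIndependent
        (fun α ↦ traceC h₂ (cupProduct h4 y (B α)) * κ) h0 α
      have htr : traceC h₂ (cupProduct h4 y (B α)) = 0 := (mul_eq_zero.1 hcoef).resolve_right hκ0
      exact eq_zero_of_traceC_eq_zero h₂ htr
    refine eq_zero_of_forall_cupPairing_eq_zero μ h₂ h4 fun y ↦ ?_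
    rw [cupPairing_apply, cupProduct_gradedComm_holds ℂ _ h4 h4, hyB y, smul_zero, map_zero,
      LinearMap.zero_apply]
  have hw₂0 : w₂ = 0 := by
    rw [hB]
    exact Finset.sum_eq_zero fun α _ ↦ by rw [hB0 α, map_zero, map_zero]
  rw [hw₂0, add_zero]
  exact hV₀N hw₀

/-! ### The reduction of `HC(S₁ × S₂)` to the transcendental correspondences -/

/-- **Rational `(2,2)`-classes on `S₁ × S₂` are algebraic as soon as the Hodge morphisms `T(S₂) → T(S₁)` are**
(for all smooth projective surfaces `S₁`, `S₂` and every orientation family `μ`): if every rational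
type-preserving `f : H²(S₂) → H²(S₁)` killing `N¹H²(S₂)` with image orthogonal to `N¹H²(S₁)` agrees on
`T(S₂)` with the action of an algebraic class of codimension `2` on `S₁ × S₂`, then every rational
`(2,2)`-class `z` of `S₁ × S₂` is algebraic — `z - Γ` acts trivially on `H²(S₂)` for the algebraic `Γ` of
`exists_algebraicClass_of_corrFst₂`, hence is divisor-supported (`mem_supportedClasses_one_of_corrFst_eq_zero₂`),
`Γ ∈ N² ⊆ N¹`, and a rational `(2,2)`-class of a fourfold supported on a divisor is algebraic
(`PgOneProductClasses.mem_algebraicClasses_two_of_mem_supportedClasses_one`: the closed item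
`NodalSupport.DivisorInduction` + Lefschetz `(1,1)`). The kernel form of "`HC(2,2)` for `S₁ × S₂` ⟸ every
Hodge morphism `T(S₂)_ℚ → T(S₁)_ℚ` is induced by an algebraic class" (stub P2 of the product-sector line of
crux `K3TypeNets`). [cite: Huybrechts2019, §1] [cite: Varesco2023, §2 (p. 8)] [cite: DeligneHodgeIII1974, Cor. 8.2.8] -/
theorem hodgeTwoTwo_algebraic_prod_of_transcendentalCorrespondences (μ : OrientationFamily)
    (h₁ : IsSmoothProjective 2 S₁) (h₂ : IsSmoothProjective 2 S₂)
    (hT : ∀ (f : complexBetti S₂ (2 * 1) →ₗ[ℂ] complexBetti S₁ (2 * 1)),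
      (∀ y, IsRationalClass y → IsRationalClass (f y)) →
      (∀ (i j : ℕ) y, IsOfHodgeType 2 S₂ (2 * 1) i j y → IsOfHodgeType 2 S₁ (2 * 1) i j (f y)) →
      (∀ d ∈ algebraicClasses S₂ 1, f d = 0) →
      (∀ y : complexBetti S₂ (2 * 1), ∀ d ∈ algebraicClasses S₁ 1,
        cupProduct (rfl : 2 * 1 + 2 * 1 = 2 * 2) (f y) d = 0) →
      ∃ γ ∈ algebraicClasses (S₁ ⊗ S₂) 2, ∀ y : complexBetti S₂ (2 * 1),
        (∀ d ∈ algebraicClasses S₂ 1, cupProduct (rfl : 2 * 1 + 2 * 1 = 2 * 2) y d = 0) →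
        f y = Corr[μ, h₁, h₂ ; γ, y])
    (c : complexBetti (S₁ ⊗ S₂) (2 * 2)) (hc : IsRationalClass c)
    (hH : IsOfHodgeType 4 (S₁ ⊗ S₂) (2 * 2) 2 2 c) : c ∈ algebraicClasses (S₁ ⊗ S₂) 2 := by
  have hX : IsSmoothProjective 4 (S₁ ⊗ S₂) := IsSmoothProjective.tensor_holds h₁ h₂
  obtain ⟨Γ, hΓalg, hΓ⟩ := exists_algebraicClass_of_corrFst₂ μ h₁ h₂ hT hc hH
  have hw : ∀ y : complexBetti S₂ (2 * 1), Corr[μ, h₁, h₂ ; c - Γ, y] = 0 := fun y ↦ by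
    rw [map_sub, map_sub, hΓ y, sub_self]
  have hN : c - Γ ∈ supportedClasses (S₁ ⊗ S₂) (2 * 2) 1 :=
    mem_supportedClasses_one_of_corrFst_eq_zero₂ μ h₁ h₂ hw
  have hΓN : Γ ∈ supportedClasses (S₁ ⊗ S₂) (2 * 2) 1 := supportedClasses_mono (S₁ ⊗ S₂) (2 * 2) one_le_two hΓalg
  have hz : c ∈ supportedClasses (S₁ ⊗ S₂) (2 * 2) 1 := by
    have h := Submodule.add_mem _ hN hΓN
    rwa [sub_add_cancel] at h
  exact PgOneProductClasses.mem_algebraicClasses_two_of_mem_supportedClasses_one hX c hc hH hz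

/-- **The Hodge conjecture for `S₁ × S₂` reduces to the transcendental correspondences `T(S₂) → T(S₁)`**:
under the hypothesis of `hodgeTwoTwo_algebraic_prod_of_transcendentalCorrespondences`,
`HodgeConjectureFor 4 (S₁ ⊗ S₂)` — codimension `2` by that theorem, codimensions `0, 1, 3, 4` by Lefschetz
`(1,1)` and hard Lefschetz (`hodgeClasses_algebraic_fourfold_of_hodgeTwoTwo`, `lefschetzOneOne_rational_holds`,
`nonempty_hardLefschetzNFold_holds`), Hodge models by `nonempty_hodgeModel_holds`.
[cite: Huybrechts2019, §1] [cite: VoisinHodgeI2002, Thm. 11.30 and Thm. 6.25] -/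
theorem hodgeConjectureFor_prod_of_transcendentalCorrespondences (μ : OrientationFamily)
    (h₁ : IsSmoothProjective 2 S₁) (h₂ : IsSmoothProjective 2 S₂)
    (hT : ∀ (f : complexBetti S₂ (2 * 1) →ₗ[ℂ] complexBetti S₁ (2 * 1)),
      (∀ y, IsRationalClass y → IsRationalClass (f y)) →
      (∀ (i j : ℕ) y, IsOfHodgeType 2 S₂ (2 * 1) i j y → IsOfHodgeType 2 S₁ (2 * 1) i j (f y)) →
      (∀ d ∈ algebraicClasses S₂ 1, f d = 0) →
      (∀ y : complexBetti S₂ (2 * 1), ∀ d ∈ algebraicClasses S₁ 1,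
        cupProduct (rfl : 2 * 1 + 2 * 1 = 2 * 2) (f y) d = 0) →
      ∃ γ ∈ algebraicClasses (S₁ ⊗ S₂) 2, ∀ y : complexBetti S₂ (2 * 1),
        (∀ d ∈ algebraicClasses S₂ 1, cupProduct (rfl : 2 * 1 + 2 * 1 = 2 * 2) y d = 0) →
        f y = Corr[μ, h₁, h₂ ; γ, y]) :
    HodgeConjectureFor 4 (S₁ ⊗ S₂) := by
  have hX : IsSmoothProjective 4 (S₁ ⊗ S₂) := IsSmoothProjective.tensor_holds h₁ h₂
  exact ⟨nonempty_hodgeModel_holds hX, fun p c hc hH ↦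
    hodgeClasses_algebraic_fourfold_of_hodgeTwoTwo lefschetzOneOne_rational_holds
      (nonempty_hardLefschetzNFold_holds 4 (S₁ ⊗ S₂)) hX
      (fun c' hc' hH' ↦ hodgeTwoTwo_algebraic_prod_of_transcendentalCorrespondences μ h₁ h₂ hT c' hc' hH')
      p c hc hH⟩

/-- **The Hodge conjecture for `S₁ × S₂` when there is no non-zero Hodge morphism `T(S₂) → T(S₁)`**
(unconditional): if every rational, type-preserving linear map `H²(S₂(ℂ); ℂ) → H²(S₁(ℂ); ℂ)` killing
`N¹H²(S₂)` with image cup-orthogonal to `N¹H²(S₁)` vanishes on `T(S₂)` — `Hom_Hdg(T(S₂), T(S₁)) = 0`, e.g.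
two K3 surfaces with non-isogenous transcendental Hodge structures, or `p_g(S₂) = 0` — then
`HodgeConjectureFor 4 (S₁ ⊗ S₂)` (take `γ = 0`). [cite: Huybrechts2019, §1 and Cor. 0.4]
[cite: VoisinHodgeI2002, §11.3.3 Lemma 11.41] -/
theorem hodgeConjectureFor_prod_of_hom_transcendental_eq_zero (h₁ : IsSmoothProjective 2 S₁)
    (h₂ : IsSmoothProjective 2 S₂)
    (hT₀ : ∀ (f : complexBetti S₂ (2 * 1) →ₗ[ℂ] complexBetti S₁ (2 * 1)),
      (∀ y, IsRationalClass y → IsRationalClass (f y)) →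
      (∀ (i j : ℕ) y, IsOfHodgeType 2 S₂ (2 * 1) i j y → IsOfHodgeType 2 S₁ (2 * 1) i j (f y)) →
      (∀ d ∈ algebraicClasses S₂ 1, f d = 0) →
      (∀ y : complexBetti S₂ (2 * 1), ∀ d ∈ algebraicClasses S₁ 1,
        cupProduct (rfl : 2 * 1 + 2 * 1 = 2 * 2) (f y) d = 0) →
      ∀ y : complexBetti S₂ (2 * 1),
        (∀ d ∈ algebraicClasses S₂ 1, cupProduct (rfl : 2 * 1 + 2 * 1 = 2 * 2) y d = 0) → f y = 0) :
    HodgeConjectureFor 4 (S₁ ⊗ S₂) :=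
  hodgeConjectureFor_prod_of_transcendentalCorrespondences complexOrientationFamily h₁ h₂
    fun f hf₁ hf₂ hf₃ hf₄ ↦ ⟨0, Submodule.zero_mem _, fun y hy ↦ by
      rw [hT₀ f hf₁ hf₂ hf₃ hf₄ y hy, map_zero, map_zero]⟩

end Summit.HodgeConjecture.HodgeConjecture.Theorems.SurfaceProducts

end
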